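import Literature.Analysis.FluidPDE.KatoSymmetryCovariance
import Literature.Analysis.FluidPDE.AxisymmetricHeatFlow
import Literature.Analysis.FluidPDE.BoundedWeakIsometry
import Literature.Analysis.FluidPDE.ClassicalSolutionRescale
import HarnessLib

/-!
# `IsobaricLinesLiouville` (stmt-NavierStokesRegularity-11741), line `Ideator2Sketch`
# (card `flux-surface-persistence`): stub `stub_covariance` (Euclidean covariance of the class)

The class {bounded ancient mild solution (`IsBoundedAncientMildSolution 1 v`, duality form)
which is also classical on `(-∞, 0)` (`IsClassicalNSSolutionOn (Iio 0) 1 0 v q`)} is invariant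
under the rigid motions `v ↦ ((t, y) ↦ R (v t (R⁻¹ y + c)))`, `q ↦ ((t, y) ↦ q t (R⁻¹ y + c))`
(`R` a linear isometry, possibly improper, `c` a translation). The motion is split into the
translation `x ↦ x + c` (tree: `IsMildNSSolutionBetween.comp_sub_right_zero`,
`IsWeaklyDivFree.comp_sub_right`, `IsClassicalNSSolutionOn.spaceTranslate`) followed by the
conjugation `u ↦ R ∘ u ∘ R⁻¹` (tree: `IsWeaklyDivFree.conj_linearIsometryEquiv`,
`IsClassicalNSSolutionOn.conj_linearIsometryEquiv`; the duality identity is proved here: test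
`R u R⁻¹` against `φ` by testing `u` against `R⁻¹ φ R`, the heat flow commuting with linear
isometries, `heatExtension_comp_linearIsometryEquiv`, and Lebesgue measure being `R`-invariant).
-/

noncomputable section

-- the summit and its single problem share the name (D-0017 nested layout)
set_option linter.dupNamespace false

open scoped InnerProductSpace RealInnerProductSpace ContDiff Laplacian
open Literature.Analysis.FluidPDE Set Function MeasureTheory

namespace Summit.NavierStokesRegularity.NavierStokesRegularity.Theorems.IsobaricLinesLiouville.FluxSurfacePersistence

open Literature.Analysis

/-! ### Conjugation of the duality identity by a linear isometry -/

namespace Covariance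

variable {E : Type*} [NormedAddCommGroup E] [InnerProductSpace ℝ E] [FiniteDimensional ℝ E]
  [MeasurableSpace E] [BorelSpace E]

omit [FiniteDimensional ℝ E] [MeasurableSpace E] [BorelSpace E] in
/-- A test field conjugated by a linear isometry, `x ↦ R⁻¹ (φ (R x))`, is a test field
(Evans, *PDE*, §5.2.1; smoothness and compact support are preserved by linear homeomorphisms).
[folklore] -/
theorem isTestFunctionOn_conj (R : E ≃ₗᵢ[ℝ] E) {φ : E → E}
    (hφ : FunctionSpaces.IsTestFunctionOn (⊤ : TopologicalSpace.Opens E) φ) :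
    FunctionSpaces.IsTestFunctionOn (⊤ : TopologicalSpace.Opens E) (fun x => R.symm (φ (R x))) where
  contDiff := R.symm.toContinuousLinearEquiv.contDiff.comp
    (hφ.contDiff.comp R.toContinuousLinearEquiv.contDiff)
  hasCompactSupport :=
    (hφ.hasCompactSupport.comp_homeomorph R.toContinuousLinearEquiv.toHomeomorph).comp_left
      (g := fun z => R.symm z) (map_zero R.symm)
  tsupport_subset := by simp

/-- **The heat flow commutes with conjugation by a linear isometry**:
`e^{σΔ}(R⁻¹ φ R)(x) = R⁻¹ (e^{σΔ}φ)(R x)` for every `σ` (the heat kernel is radial and Lebesgue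
measure is `R`-invariant, `heatExtension_comp_linearIsometryEquiv`; linearity in the values,
`heatExtension_continuousLinearEquiv_comp`; Evans, *PDE*, §2.3.1). [folklore] -/
theorem heatFlow_conj (R : E ≃ₗᵢ[ℝ] E) (φ : E → E) (σ : ℝ) (x : E) :
    heatFlow (fun y => R.symm (φ (R y))) σ x = R.symm (heatFlow φ σ (R x)) := by
  rcases le_or_gt σ 0 with h | h
  · rw [heatFlow_of_nonpos _ h, heatFlow_of_nonpos _ h]
  · rw [heatFlow_of_pos _ h, heatFlow_of_pos _ h]
    have h1 : (fun y => R.symm (φ (R y))) =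
        fun y => R.symm.toContinuousLinearEquiv ((fun z => φ (R z)) y) := rfl
    rw [h1, heatExtension_continuousLinearEquiv_comp, heatExtension_comp_linearIsometryEquiv]
    rfl

/-- The caloric test field `e^{ντΔ}φ` commutes with conjugation by a linear isometry
(Fabes–Jones–Rivière 1972, §2; `heatFlow_conj` at elapsed time `ν τ`). [folklore] -/
theorem heatTest_conj (R : E ≃ₗᵢ[ℝ] E) (ν : ℝ) (φ : E → E) (τ : ℝ) (x : E) :
    heatTest ν (fun y => R.symm (φ (R y))) τ x = R.symm (heatTest ν φ τ (R x)) :=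
  heatFlow_conj R φ (ν * τ) x

/-- **Conjugation of pairings**: `∫ ⟪R U(R⁻¹ y), Φ(y)⟫ dy = ∫ ⟪U(x), R⁻¹ Φ(R x)⟫ dx`
(substitute `y = R x`, a measure-preserving linear isometry, and move `R` across the inner
product, `⟪R a, b⟫ = ⟪a, R⁻¹ b⟫`; unconditional). [folklore] -/
theorem integral_inner_conj (R : E ≃ₗᵢ[ℝ] E) (U Φ : E → E) :
    ∫ y, ⟪R (U (R.symm y)), Φ y⟫ = ∫ x, ⟪U x, R.symm (Φ (R x))⟫ := by
  have hR : MeasurePreserving (R : E → E) volume volume := R.measurePreserving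
  rw [← hR.integral_comp R.toHomeomorph.measurableEmbedding]
  congr 1
  funext x
  simp only [LinearIsometryEquiv.symm_apply_apply, LinearIsometryEquiv.inner_map_eq_flip]

omit [FiniteDimensional ℝ E] [MeasurableSpace E] [BorelSpace E] in
/-- The convective derivative under conjugation, read from the un-conjugated side:
`((U·∇)(R⁻¹ W R))(x) = R⁻¹ (((R U R⁻¹)·∇) W)(R x)` (Majda–Bertozzi, §1.2, Prop. 1.1 (iii);
`convect_conj_linearIsometryEquiv` for `R⁻¹`). [folklore] -/
theorem convect_conj' (R : E ≃ₗᵢ[ℝ] E) (U W : E → E) (x : E) :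
    convect U (fun y => R.symm (W (R y))) x =
      R.symm (convect (fun y => R (U (R.symm y))) W (R x)) := by
  have h1 := convect_conj_linearIsometryEquiv R.symm (fun y => R (U (R.symm y))) W x
  simp only [LinearIsometryEquiv.symm_symm, LinearIsometryEquiv.symm_apply_apply] at h1
  exact h1

/-- **The unforced two-time duality identity is invariant under conjugation by a linear
isometry** (Fabes–Jones–Rivière 1972, Thm. 2.1, with Majda–Bertozzi, Prop. 1.1 (iii)): if it
holds for `u` between `s` and `t`, it holds for `(τ, y) ↦ R (u τ (R⁻¹ y))` — each term equals the
corresponding term for `u` tested against the conjugated test field `R⁻¹ φ R`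
(`integral_inner_conj`, `heatTest_conj`, `convect_conj'`). [folklore] -/
theorem isMildNSSolutionBetween_conj (R : E ≃ₗᵢ[ℝ] E) {ν : ℝ} {u : ℝ → E → E} {s t : ℝ}
    (h : IsMildNSSolutionBetween ν 0 u s t) :
    IsMildNSSolutionBetween ν 0 (fun τ y => R (u τ (R.symm y))) s t := by
  intro φ hφ hdiv
  have hψdiv : VectorCalculus.IsDivFree (fun x => R.symm (φ (R x))) := by
    have h1 := hdiv.conj_linearIsometryEquiv R.symm
    simp only [LinearIsometryEquiv.symm_symm] at h1
    exact h1
  have key := h _ (isTestFunctionOn_conj R hφ) hψdiv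
  simp only [Pi.zero_apply, inner_zero_left, integral_zero, intervalIntegral.integral_zero,
    add_zero] at key ⊢
  -- left-hand side
  have e1 : ∫ y, ⟪R (u t (R.symm y)), φ y⟫ = ∫ x, ⟪u t x, R.symm (φ (R x))⟫ :=
    integral_inner_conj R _ _
  -- datum term
  have e2 : ∫ y, ⟪R (u s (R.symm y)), heatTest ν φ (t - s) y⟫ =
      ∫ x, ⟪u s x, heatTest ν (fun x => R.symm (φ (R x))) (t - s) x⟫ := by
    rw [integral_inner_conj R (u s) (heatTest ν φ (t - s))]
    simp_rw [heatTest_conj]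
  -- nonlinear term, slice by slice
  have e3 : ∀ τ, ∫ y, ⟪R (u τ (R.symm y)),
      convect (fun y => R (u τ (R.symm y))) (heatTest ν φ (t - τ)) y⟫ =
      ∫ x, ⟪u τ x, convect (u τ) (heatTest ν (fun x => R.symm (φ (R x))) (t - τ)) x⟫ := by
    intro τ
    have hW : heatTest ν (fun x => R.symm (φ (R x))) (t - τ) =
        fun y => R.symm (heatTest ν φ (t - τ) (R y)) := by
      funext y
      exact heatTest_conj R ν φ (t - τ) y
    rw [integral_inner_conj R (u τ) (convect (fun y => R (u τ (R.symm y))) (heatTest ν φ (t - τ))),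
      hW]
    congr 1
    funext x
    rw [convect_conj']
  simp_rw [e3]
  rw [e1, e2, key]

/-! ### Covariance of the class under linear isometries and translations -/

/-- **Bounded ancient mild solutions are invariant under conjugation by a linear isometry**
(KNSS 2009, §1; Majda–Bertozzi, Prop. 1.1 (iii)): weak divergence-freeness of the slices
(`IsWeaklyDivFree.conj_linearIsometryEquiv`), the duality identity
(`isMildNSSolutionBetween_conj`) and the `L^∞` bound (`‖R a‖ = ‖a‖`) are all preserved.
[folklore] -/
theorem isBoundedAncientMildSolution_conj (R : E ≃ₗᵢ[ℝ] E) {ν : ℝ} {u : ℝ → E → E}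
    (h : IsBoundedAncientMildSolution ν u) :
    IsBoundedAncientMildSolution ν (fun t y => R (u t (R.symm y))) := by
  obtain ⟨⟨hdiv, hmild⟩, C, hC⟩ := h
  refine ⟨⟨fun t ht => (hdiv t ht).conj_linearIsometryEquiv R,
    fun s t hst ht => isMildNSSolutionBetween_conj R (hmild s t hst ht)⟩, C, fun t ht y => ?_⟩
  rw [LinearIsometryEquiv.norm_map]
  exact hC t ht _

/-- **Bounded ancient mild solutions are invariant under space translations** `x ↦ x + c`
(KNSS 2009, §1; tree: `IsWeaklyDivFree.comp_sub_right`,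
`IsMildNSSolutionBetween.comp_sub_right_zero` with `a = -c`). [folklore] -/
theorem isBoundedAncientMildSolution_comp_add_right {ν : ℝ} {u : ℝ → E → E}
    (h : IsBoundedAncientMildSolution ν u) (c : E) :
    IsBoundedAncientMildSolution ν (fun t x => u t (x + c)) := by
  have e : (fun t x => u t (x + c)) = fun t x => u t (x - -c) := by
    funext t x
    rw [sub_neg_eq_add]
  rw [e]
  obtain ⟨⟨hdiv, hmild⟩, C, hC⟩ := h
  exact ⟨⟨fun t ht => (hdiv t ht).comp_sub_right (-c),
    fun s t hst ht => (hmild s t hst ht).comp_sub_right_zero (-c)⟩, C, fun t ht x => hC t ht _⟩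

omit [MeasurableSpace E] [BorelSpace E] in
/-- **Unforced classical solutions are covariant under rigid motions** (Majda–Bertozzi, §1.2,
Prop. 1.1 (ii)–(iii)): on a time set of unique differentiability,
`(t, y) ↦ R (u t (R⁻¹ y + c))`, `(t, y) ↦ p t (R⁻¹ y + c)` is again a classical solution of the
unforced system (tree: `IsClassicalNSSolutionOn.spaceTranslate`, then
`IsClassicalNSSolutionOn.conj_linearIsometryEquiv`; the zero force is fixed). [folklore] -/
theorem isClassicalNSSolutionOn_euclid (R : E ≃ₗᵢ[ℝ] E) (c : E) {S : Set ℝ}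
    (hS : UniqueDiffOn ℝ S) {ν : ℝ} {u : ℝ → E → E} {p : ℝ → E → ℝ}
    (h : IsClassicalNSSolutionOn S ν 0 u p) :
    IsClassicalNSSolutionOn S ν 0 (fun t y => R (u t (R.symm y + c)))
      (fun t y => p t (R.symm y + c)) := by
  have h1 : IsClassicalNSSolutionOn S ν 0 (fun t x => u t (x + c)) (fun t x => p t (x + c)) := by
    have h0 := (h.spaceTranslate c).congr_force (g := 0) (fun t _ x => rfl)
    have eu : (fun t x => u t (c + x)) = fun t x => u t (x + c) := by
      funext t x
      rw [add_comm]
    have ep : (fun t x => p t (c + x)) = fun t x => p t (x + c) := by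
      funext t x
      rw [add_comm]
    rw [eu, ep] at h0
    exact h0
  exact (h1.conj_linearIsometryEquiv R hS).congr_force (g := 0) (fun t _ x => by simp)

end Covariance

/-! ### The stub -/

/-- **Euclidean covariance of the class**: for a rigid motion `x ↦ R x` followed by the shift of the
argument by `c` (`R` a linear isometry, possibly improper), the conjugated field
`v' t y := R (v t (R⁻¹ y + c))` with pressure `q' t y := q t (R⁻¹ y + c)` is again a bounded ancient
mild solution (duality identity: test fields, the heat flow and Lebesgue measure are
`E(3)`-invariant) and a classical solution on `(-∞,0)` (chain rule; `Δ`, `div`, `∇` are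
`O(3)`-equivariant). Koch–Nadirashvili–Seregin–Šverák 2009, §1; Majda–Bertozzi, §1.2,
Prop. 1.1. [folklore] -/
theorem stub_covariance :
    ∀ (v : ℝ → (EuclideanSpace ℝ (Fin 3)) → (EuclideanSpace ℝ (Fin 3))) (q : ℝ → (EuclideanSpace ℝ (Fin 3)) → ℝ) (R : (EuclideanSpace ℝ (Fin 3)) ≃ₗᵢ[ℝ] (EuclideanSpace ℝ (Fin 3))) (c : (EuclideanSpace ℝ (Fin 3))),
      IsBoundedAncientMildSolution 1 v → IsClassicalNSSolutionOn (Set.Iio 0) 1 0 v q →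
        IsBoundedAncientMildSolution 1 (fun t y => R (v t (R.symm y + c))) ∧
          IsClassicalNSSolutionOn (Set.Iio 0) 1 0 (fun t y => R (v t (R.symm y + c)))
            (fun t y => q t (R.symm y + c)) := by
  intro v q R c hanc hcl
  have h1 : IsBoundedAncientMildSolution 1 (fun t x => v t (x + c)) :=
    Covariance.isBoundedAncientMildSolution_comp_add_right hanc c
  have h2 : IsBoundedAncientMildSolution 1 (fun t y => R (v t (R.symm y + c))) :=
    Covariance.isBoundedAncientMildSolution_conj R h1
  exact ⟨h2, Covariance.isClassicalNSSolutionOn_euclid R c (uniqueDiffOn_Iio 0) hcl⟩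

end Summit.NavierStokesRegularity.NavierStokesRegularity.Theorems.IsobaricLinesLiouville.FluxSurfacePersistence

end
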